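import Literature.Analysis.Complex.DbarAlongCalculus
import Mathlib.MeasureTheory.Function.StronglyMeasurable.Basic
import Mathlib.MeasureTheory.Constructions.BorelSpace.Complex
import HarnessLib

/-!
# Hartman–Wintner: the localised function `φ = χ • w` and the densities `z^{-k} ∂̄φ`

Elementary bookkeeping for the Hartman–Wintner theorem
(`Literature/Analysis/Complex/HartmanWintner.lean`; Hartman–Wintner (1953), Schulz (1990) §7.1).

**Setting** (the hypotheses `hρm … hmw` of the sections below, shared verbatim with
`HartmanWintnerBootstrap.lean` and `HartmanWintner.lean`): radii `0 < ρₘ < ρ < r`; a map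
`w : ℂ → F` into a complex normed space, `C¹` on `B(0, r)` with `‖∂̄w‖ ≤ K‖w‖` there
(`∂̄ = Literature.Analysis.Complex.dbarAlong 1 = ½(∂ₓ + i∂_y)`, `K ≥ 0`); a `C¹` cut-off `χ`
with `χ = 1` on `B̄(0, ρₘ)`, `tsupport χ ⊆ B(0, ρ)`, `‖χ‖ ≤ 1`, `‖∂̄χ‖ ≤ L`; and
`m ≥ sup_{B(0,ρ)} ‖w‖`. The localised function is `φ = χ • w ∈ C¹_c(ℂ, F)` (`contDiff_phi`,
`hasCompactSupport_phi`), with `∂̄φ = ∂̄χ • w + χ • ∂̄w` (`dbar_phi_eq`), so that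
`‖∂̄φ‖ ≤ K‖w‖` on `B(0, ρₘ)` (`norm_dbar_phi_le_inner`), `‖∂̄φ‖ ≤ (L + K)‖w‖` on `B(0, r)`
(`norm_dbar_phi_le`) and `∂̄φ = 0` off `B(0, ρ)` (`dbar_phi_eq_zero`). The stage-`k` density of
the Cauchy–Green representation is `f_k = z^{-k} ∂̄φ`; if `‖w z‖ ≤ A|z|^k` on `B̄(0, ρₘ)` then
`‖f_k‖ ≤ K A + (L + K) m ρₘ^{-k}` everywhere (`norm_density_le`).

## References

* P. Hartman, A. Wintner, *On the local behavior of solutions of non-parabolic partial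
  differential equations*, Amer. J. Math. 75 (1953), 449–476. [HartmanWintner1953]
* F. Schulz, *Regularity theory for quasilinear elliptic systems and Monge–Ampère equations in two
  dimensions*, Springer LNM 1445 (1990), §7.1. [SchulzRegularity1990]
-/

noncomputable section

open MeasureTheory Metric Set Filter Topology Complex
open scoped Real ContDiff

namespace Literature.Analysis.Complex

namespace HartmanWintner

variable {F : Type*} [NormedAddCommGroup F] [NormedSpace ℂ F]
variable {w : ℂ → F} {χ : ℂ → ℂ} {K L m r ρ ρm : ℝ}

/-! ### The localised function `φ = χ • w` and its `∂̄` -/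

section Phi

variable (hρ : ρm < ρ) (hr : ρ < r) (hw : ContDiffOn ℝ 1 w (ball 0 r))
  (hχ : ContDiff ℝ 1 χ) (hχs : tsupport χ ⊆ ball 0 ρ)

include hr hw hχ hχs in
/-- `φ = χ • w` is `C¹` on all of `ℂ` (extension by zero off `tsupport χ ⊆ B(0, ρ) ⊆ B(0, r)`).
[folklore] -/
theorem contDiff_phi : ContDiff ℝ 1 fun z => χ z • w z :=
  contDiff_smul_of_tsupport_subset isOpen_ball hχ (hχs.trans (ball_subset_ball hr.le)) hw

include hχs in
/-- `χ` vanishes off `B(0, ρ)`. [folklore] -/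
theorem chi_eq_zero {z : ℂ} (hz : ρ ≤ ‖z‖) : χ z = 0 :=
  image_eq_zero_of_notMem_tsupport fun h => by
    have := mem_ball_zero_iff.1 (hχs h)
    linarith

include hχs in
/-- `φ = χ • w` has compact support (inside `B̄(0, ρ)`). [folklore] -/
theorem hasCompactSupport_phi : HasCompactSupport fun z => χ z • w z :=
  HasCompactSupport.intro (isCompact_closedBall (0 : ℂ) ρ) fun z hz => by
    rw [mem_closedBall_zero_iff, not_le] at hz
    simp [chi_eq_zero hχs hz.le]

include hχs in
/-- `φ` vanishes off `B(0, ρ)`. [folklore] -/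
theorem phi_eq_zero {z : ℂ} (hz : ρ ≤ ‖z‖) : χ z • w z = 0 := by
  simp [chi_eq_zero hχs hz]

include hw hχ in
/-- **Leibniz**: `∂̄φ = ∂̄χ • w + χ • ∂̄w` on `B(0, r)`. [folklore] -/
theorem dbar_phi_eq {z : ℂ} (hz : ‖z‖ < r) :
    dbarAlong 1 (fun y => χ y • w y) z = dbarAlong 1 χ z • w z + χ z • dbarAlong 1 w z :=
  dbarAlong_smul (hχ.differentiable one_ne_zero z)
    ((hw.differentiableOn one_ne_zero).differentiableAt (isOpen_ball.mem_nhds (mem_ball_zero_iff.2 hz)))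
    1

include hχs in
/-- `∂̄φ = 0` off `B(0, ρ)`. [folklore] -/
theorem dbar_phi_eq_zero {z : ℂ} (hz : ρ ≤ ‖z‖) : dbarAlong 1 (fun y => χ y • w y) z = 0 := by
  refine dbarAlong_eq_zero_of_eventuallyEq_zero ?_ 1
  have hχ0 : χ =ᶠ[𝓝 z] 0 := notMem_tsupport_iff_eventuallyEq.1 fun h => by
    have := mem_ball_zero_iff.1 (hχs h)
    linarith
  filter_upwards [hχ0] with y hy
  simp [hy]

variable (hρm : 0 < ρm) (hK : 0 ≤ K) (hdbar : ∀ z ∈ ball (0 : ℂ) r, ‖dbarAlong 1 w z‖ ≤ K * ‖w z‖)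
  (hχ1 : ∀ z : ℂ, ‖z‖ ≤ ρm → χ z = 1) (hχle : ∀ z, ‖χ z‖ ≤ 1)
  (hL : 0 ≤ L) (hLχ : ∀ z, ‖dbarAlong 1 χ z‖ ≤ L)

include hρ hr hw hχ hdbar hχ1 hχle in
/-- Near the origin (`|z| < ρₘ`, where `χ ≡ 1`): `‖∂̄φ z‖ ≤ K ‖w z‖`. [folklore] -/
theorem norm_dbar_phi_le_inner {z : ℂ} (hz : ‖z‖ < ρm) :
    ‖dbarAlong 1 (fun y => χ y • w y) z‖ ≤ K * ‖w z‖ := by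
  have hzr : ‖z‖ < r := by linarith
  have hχz : dbarAlong 1 χ z = 0 := by
    have h1 : χ =ᶠ[𝓝 z] fun _ => (1 : ℂ) := by
      filter_upwards [isOpen_ball.mem_nhds (mem_ball_zero_iff.2 hz)] with y hy
      exact hχ1 y (mem_ball_zero_iff.1 hy).le
    rw [dbarAlong_congr_of_eventuallyEq h1 1, dbarAlong_apply]
    simp
  rw [dbar_phi_eq hw hχ hzr, hχz, zero_smul, zero_add, norm_smul]
  calc ‖χ z‖ * ‖dbarAlong 1 w z‖ ≤ 1 * (K * ‖w z‖) :=
        mul_le_mul (hχle z) (hdbar z (mem_ball_zero_iff.2 hzr)) (norm_nonneg _) zero_le_one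
    _ = K * ‖w z‖ := one_mul _

include hw hχ hdbar hχle hLχ in
/-- On `B(0, r)`: `‖∂̄φ z‖ ≤ (L + K) ‖w z‖`. [folklore] -/
theorem norm_dbar_phi_le {z : ℂ} (hz : ‖z‖ < r) :
    ‖dbarAlong 1 (fun y => χ y • w y) z‖ ≤ (L + K) * ‖w z‖ := by
  rw [dbar_phi_eq hw hχ hz]
  calc ‖dbarAlong 1 χ z • w z + χ z • dbarAlong 1 w z‖
      ≤ ‖dbarAlong 1 χ z‖ * ‖w z‖ + ‖χ z‖ * ‖dbarAlong 1 w z‖ := by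
        refine (norm_add_le _ _).trans ?_
        rw [norm_smul, norm_smul]
    _ ≤ L * ‖w z‖ + 1 * (K * ‖w z‖) :=
        add_le_add (mul_le_mul_of_nonneg_right (hLχ z) (norm_nonneg _))
          (mul_le_mul (hχle z) (hdbar z (mem_ball_zero_iff.2 hz)) (norm_nonneg _) zero_le_one)
    _ = (L + K) * ‖w z‖ := by ring

variable (hm : 0 ≤ m) (hmw : ∀ z : ℂ, ‖z‖ < ρ → ‖w z‖ ≤ m)

include hρm hρ hr hw hK hdbar hχ hχ1 hχs hχle hL hLχ hm hmw in
/-- **Bounds for the density `f_k = z^{-k} ∂̄φ`.** If `‖w z‖ ≤ A |z|^k` on `B̄(0, ρₘ)` then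
`‖z^{-k} ∂̄φ(z)‖ ≤ K A + (L + K) m ρₘ^{-k}` everywhere. [folklore] -/
theorem norm_density_le (k : ℕ) {A : ℝ} (hA : 0 ≤ A)
    (hwA : ∀ z : ℂ, ‖z‖ ≤ ρm → ‖w z‖ ≤ A * ‖z‖ ^ k) (z : ℂ) :
    ‖(z ^ k)⁻¹ • dbarAlong 1 (fun y => χ y • w y) z‖ ≤ K * A + (L + K) * m * (ρm ^ k)⁻¹ := by
  have h2 : 0 ≤ (L + K) * m * (ρm ^ k)⁻¹ := by positivity
  have h1 : 0 ≤ K * A := by positivity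
  rw [norm_smul, norm_inv, norm_pow]
  by_cases hz : ‖z‖ < ρm
  · -- inner region
    have hb := norm_dbar_phi_le_inner hρ hr hw hχ hdbar hχ1 hχle hz
    calc (‖z‖ ^ k)⁻¹ * ‖dbarAlong 1 (fun y => χ y • w y) z‖
        ≤ (‖z‖ ^ k)⁻¹ * (K * (A * ‖z‖ ^ k)) := by
          gcongr
          exact hb.trans (mul_le_mul_of_nonneg_left (hwA z hz.le) hK)
      _ = K * A * ((‖z‖ ^ k)⁻¹ * ‖z‖ ^ k) := by ring
      _ ≤ K * A * 1 := by
          gcongr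
          by_cases h0 : ‖z‖ ^ k = 0
          · rw [h0, mul_zero]; exact zero_le_one
          · rw [inv_mul_cancel₀ h0]
      _ ≤ K * A + (L + K) * m * (ρm ^ k)⁻¹ := by linarith
  · rw [not_lt] at hz
    by_cases hz' : ‖z‖ < ρ
    · have hb := norm_dbar_phi_le hw hχ hdbar hχle hLχ (hz'.trans hr)
      calc (‖z‖ ^ k)⁻¹ * ‖dbarAlong 1 (fun y => χ y • w y) z‖
          ≤ (ρm ^ k)⁻¹ * ((L + K) * m) := by
            refine mul_le_mul ?_ (hb.trans ?_) (norm_nonneg _) (by positivity)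
            · exact inv_anti₀ (by positivity) (pow_le_pow_left₀ hρm.le hz k)
            · exact mul_le_mul_of_nonneg_left (hmw z hz') (by positivity)
        _ = (L + K) * m * (ρm ^ k)⁻¹ := by ring
        _ ≤ K * A + (L + K) * m * (ρm ^ k)⁻¹ := by linarith
    · rw [not_lt] at hz'
      rw [dbar_phi_eq_zero hχs hz', norm_zero, mul_zero]
      positivity

include hχs in
/-- The density `f_k = z^{-k} ∂̄φ` vanishes off `B(0, ρ)`. [folklore] -/
theorem density_support (k : ℕ) (z : ℂ)
    (hz : (z ^ k)⁻¹ • dbarAlong 1 (fun y => χ y • w y) z ≠ 0) : ‖z‖ < ρ := by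
  by_contra h
  exact hz (by rw [dbar_phi_eq_zero hχs (not_lt.1 h), smul_zero])

include hr hw hχ hχs in
/-- The density `f_k` is (a.e. strongly) measurable. [folklore] -/
theorem aestronglyMeasurable_density (k : ℕ) :
    AEStronglyMeasurable (fun z : ℂ => (z ^ k)⁻¹ • dbarAlong 1 (fun y => χ y • w y) z) volume :=
  ((measurable_id.pow_const k).inv.aestronglyMeasurable).smul
    (continuous_dbarAlong (contDiff_phi hr hw hχ hχs) 1).aestronglyMeasurable

end Phi

end HartmanWintner

end Literature.Analysis.Complex

end
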